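import Literature.NumberTheory.Sieve.FriedlanderIwaniecPrimesDirichletSymbol
import Literature.NumberTheory.QuadraticFields.GaussianNormCount
import Literature.NumberTheory.Sieve.DivisorBound
import Mathlib.FieldTheory.Finite.Basic
import Mathlib.Data.Nat.Factorization.Basic
import Mathlib.Analysis.Complex.Basic
import Mathlib.Algebra.Order.BigOperators.Ring.Finset
import HarnessLib

/-!
# Friedlander–Iwaniec, *The polynomial `X² + Y⁴` captures its primes*, §21: Lemma 21.1 (vanishing case) and Lemma 21.2 for the bilinear form `Q(M, N)`

Family `parity`, statement parity.S17. Source: J. Friedlander, H. Iwaniec, Ann. of Math. (2) 148 (1998),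
945–1040 [FriedlanderIwaniecAnnals1998], §21 "Bilinear forms in Dirichlet symbols", (21.1)–(21.8):
`Q(M, N) = Σ*_w Σ_z α_w β_z (z/w)` with `α` supported on primary primitive `w`, `|w|² ≤ M`, and `β` on
`|z|² ≤ N`, `|α|, |β| ≤ 1`; Lemma 21.1 (21.7): for `w₁, w₂` primary primitive, `q = |w₁w₂|²`,
`d = |(w₁, w̄₂)|²`, "`Σ_{ζ (mod q)} (ζ/w₁)(ζ/w₂) = qφ(d)φ(q/d)` if `q` and `d` are squares, `0` otherwise";
Lemma 21.2 (21.8): `Q(M, N) ≪ {M³ N^{1/2} + M² N^{3/4} + M^{1/2} N}(MN)^ε`, by Cauchy, splitting `z` into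
residue classes modulo `q = |w₁ w₂|²`, and Lemma 21.1.

This file continues the tree's `FriedlanderIwaniecPrimesDirichletSymbol` (§19: `dirichletSym z w = (z/w)`,
`dirichletSym_mul_left`, `dirichletSym_eq_of_dvd_sub`, `dirichletSym_intCast`, `dirichletSym_comm`).
Everything here is PROVED; the sequel `FriedlanderIwaniecPrimesDirichletBilinearBound` proves (21.9) (the
Hölder step, `k = 6`) and Proposition 21.3 for `Q*(M, N)` from it.

* `sum_dirichletSym_mul_eq_zero` — **the vanishing half of Lemma 21.1**, which is all that (21.8) uses: for
  `w₁, w₂` primary primitive with `|w₁|²|w₂|²` NOT a perfect square, `Σ_{ζ mod q} (ζ/w₁)(ζ/w₂) = 0` over the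
  complete residue system `{r + is : 0 ≤ r, s < q}`, `q = |w₁|²|w₂|²`. Proof (not the source's change of
  variables through `ω² ≡ -1`): the summand `F` has `F(cζ) = J(c | q) F(ζ)` for `c ∈ ℤ` (multiplicativity and
  (19.3)); an odd non-square modulus has a Jacobi non-residue (`exists_jacobiSym_eq_neg_one`: `q = p^e m`,
  `e` odd, `p ∤ m`, `c` a non-residue mod `p`, `≡ 1 (mod m)`); and `ζ ↦ cζ` permutes the residue system, so
  `S = -S`. (The exact value `qφ(d)φ(q/d)` in the square case is not needed — (21.8) uses the trivial bound —
  and is not proved.)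
* `dirichletBilin α β W Z = Σ_{w ∈ W} Σ_{z ∈ Z} α w β z (z/w)` — (21.1) over finite index sets;
* `norm_sq_dirichletBilin_box_le` — **Lemma 21.2 in box form**: for `W` a finite set of primary primitive `w`
  with `|w|² ≤ M`, `|α| ≤ 1`, arbitrary `β`, and `Z = gaussBox X` the lattice box `|Re z|, |Im z| ≤ X`:
  `‖Q‖² ≤ ‖β‖₂² · ((2X+1)² · SQ(W) + 2 M² (2X+1) · |W|²)`, where `SQ(W) = #{(w₁, w₂) ∈ W² : |w₁|²|w₂|² = □}`;
* `card_sqNormPairs_le_sum`, `card_sqNormPairs_le_rpow` — `SQ(W) ≤ Σ_{t ≤ M} 16 τ(t²)³ ≪_ε M^{1+ε}` (the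
  source's "`N² Σ_{m₁ m₂ = □} τ(m₁ m₂)`", via `r(n) ≤ 4 τ(n)` of `GaussianNormCount` and the divisor bound);
* small API: `abs_dirichletSym_le`, `dirichletSym_pow`, `dirichletSym_prod`, `dirichletSym_intCast_mul`,
  `dirichletSym_congr` (periodicity in coordinates), `natAbs_norm_ne_zero_of_isPrimary`.

## Why boxes, and how this is Lemma 21.2

A disc `|z|² ≤ N` is contained in the box `X = ⌊√N⌋`, and (21.1) only constrains the *support* of `β`, so a
bound for all `β` on the box is a bound for all `β` on the disc. On a box the analytic input of the proof
— "splitting the inner summation into residue classes `ζ (mod q)` … `Σ_ζ (ζ/w₁)(ζ/w₂){πN/q² + O(√N/q + 1)}`"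
— needs no lattice-point geometry: a `q`-periodic function on `ℤ²` whose sum over a complete residue system
vanishes has box sums bounded by `2q(2X+1)` (`abs_sum_box_le_of_periodic`: the box is `kq + ρ` consecutive
integers in each direction; the `kq × kq` part is a union of complete residue systems). With `‖β‖₂² ≤ 9N`,
`|W| ≤ 9M`, `q ≤ M²` this gives `Q ≪ (M^{1/2} N + M² N^{3/4})(MN)^ε`, i.e. (21.8) without its (redundant)
first term.

## References

* J. Friedlander, H. Iwaniec, Ann. of Math. (2) 148 (1998), 945–1040, §19 (19.3), (19.10); §21 (21.1)–(21.8),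
  Lemmas 21.1, 21.2. [FriedlanderIwaniecAnnals1998]

## Mathlib / tree

Mathlib: `Finset.sum_mul_sq_le_sq_mul_sq` (Cauchy–Schwarz), `Complex.mul_conj`, `Complex.normSq_eq_norm_sq`,
`Finset.Ico_union_Ico_eq_Ico`, `Int.card_Ico`, `FiniteField.exists_nonsquare`, `Nat.chineseRemainder`,
`Nat.ordProj_mul_ordCompl_eq_self`, `jacobiSym.legendreSym.to_jacobiSym`. Tree: `dirichletSym`,
`dirichletSym_mul_left`, `dirichletSym_eq_of_dvd_sub`, `dirichletSym_intCast`, `dirichletSym_trichotomy`,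
`odd_natAbs_norm_of_isPrimary` (`…DirichletSymbol`); `gaussBox`, `normEq`, `card_normEq_le` (`GaussianNormCount`);
`exists_card_divisors_le_mul_rpow` (`DivisorBound`).
-/

noncomputable section

open scoped NumberTheorySymbols ComplexConjugate
open Finset

namespace Literature.NumberTheory.Sieve.FriedlanderIwaniecPrimes

open Literature.NumberTheory.QuadraticFields.GaussianPrimary
open Literature.NumberTheory.LFunctions.GaussianTheta (normEq mem_normEq)
open Literature.NumberTheory.LFunctions.GaussianInt (IsPrimitive)


/-! ### Small API on top of `dirichletSym` -/

/-- The norm of a primary Gaussian integer is nonzero (as a natural number). [folklore] -/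
theorem natAbs_norm_ne_zero_of_isPrimary {w : GaussianInt} (hw : IsPrimary w) : w.norm.natAbs ≠ 0 :=
  (odd_natAbs_norm_of_isPrimary hw).pos.ne'

/-- `|(z/w)| ≤ 1`. [folklore] -/
theorem abs_dirichletSym_le (z w : GaussianInt) : |dirichletSym z w| ≤ 1 := by
  rcases dirichletSym_trichotomy z w with h | h | h <;> simp [h]

/-- `‖(z/w)‖ ≤ 1` in `ℂ`. [folklore] -/
theorem norm_cast_dirichletSym_le (z w : GaussianInt) : ‖((dirichletSym z w : ℤ) : ℂ)‖ ≤ 1 := by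
  rcases dirichletSym_trichotomy z w with h | h | h <;> simp [h]

/-- `ξ_w` on powers. [cite: FriedlanderIwaniecAnnals1998, §19 after (19.2)] -/
theorem dirichletSym_pow {w : GaussianInt} (hw : IsPrimary w) (hw' : IsPrimitive w) (z : GaussianInt)
    (k : ℕ) : dirichletSym (z ^ k) w = dirichletSym z w ^ k := by
  induction k with
  | zero => simp [dirichletSym_one hw hw']
  | succ k ih => rw [pow_succ, dirichletSym_mul_left hw hw', ih, pow_succ]

/-- `ξ_w` on finite products (complete multiplicativity). [cite: FriedlanderIwaniecAnnals1998, §19 after (19.2)] -/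
theorem dirichletSym_prod {w : GaussianInt} (hw : IsPrimary w) (hw' : IsPrimitive w) {ι : Type*}
    (s : Finset ι) (f : ι → GaussianInt) :
    dirichletSym (∏ i ∈ s, f i) w = ∏ i ∈ s, dirichletSym (f i) w := by
  classical
  induction s using Finset.induction_on with
  | empty => simp [dirichletSym_one hw hw']
  | insert a s ha ih => rw [prod_insert ha, prod_insert ha, dirichletSym_mul_left hw hw', ih]

/-- `(c z / w) = J(c | q) (z / w)` for `c ∈ ℤ`. [cite: FriedlanderIwaniecAnnals1998, (19.3)] -/
theorem dirichletSym_intCast_mul {w : GaussianInt} (hw : IsPrimary w) (hw' : IsPrimitive w) (c : ℤ)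
    (z : GaussianInt) : dirichletSym ((c : GaussianInt) * z) w = J(c | w.norm.natAbs) * dirichletSym z w := by
  rw [dirichletSym_mul_left hw hw', dirichletSym_intCast hw hw']

/-- Periodicity in coordinates: `(z/w) = (z'/w)` when `q ∣ Re(z - z')` and `q ∣ Im(z - z')`, `q = |w|²`.
[cite: FriedlanderIwaniecAnnals1998, §19 after (19.2)] -/
theorem dirichletSym_congr (w : GaussianInt) {z z' : GaussianInt} (hre : (w.norm.natAbs : ℤ) ∣ z.re - z'.re)
    (him : (w.norm.natAbs : ℤ) ∣ z.im - z'.im) : dirichletSym z w = dirichletSym z' w := by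
  refine dirichletSym_eq_of_dvd_sub ?_
  have h : (((w.norm.natAbs : ℤ) : GaussianInt)) ∣ z - z' :=
    (Zsqrtd.intCast_dvd _ _).mpr ⟨by simpa using hre, by simpa using him⟩
  simpa using h

/-! ### A non-square odd modulus has a Jacobi non-residue -/

/-- For an odd `b` which is not a perfect square there is `c` with `J(c | b) = -1`: write `b = p^e m` with `e`
odd and `p ∤ m`, and take `c ≡` a non-residue `(mod p)`, `c ≡ 1 (mod m)`. [folklore] -/
theorem exists_jacobiSym_eq_neg_one {b : ℕ} (hb : Odd b) (hsq : ¬ IsSquare b) : ∃ c : ℕ, J((c : ℤ) | b) = -1 := by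
  have hb0 : 0 < b := Nat.pos_of_ne_zero fun h => hsq (h ▸ ⟨0, rfl⟩)
  obtain ⟨a, t, ha, ht, hbat, hsqf⟩ := Nat.sq_mul_squarefree_of_pos hb0
  have ha1 : a ≠ 1 := by rintro rfl; exact hsq ⟨t, by rw [← hbat]; ring⟩
  obtain ⟨p, hp, hpa⟩ := Nat.exists_prime_and_dvd ha1
  haveI := Fact.mk hp
  have hab : a ∣ b := ⟨t ^ 2, by rw [← hbat]; ring⟩
  have hp2 : p ≠ 2 := by
    rintro rfl
    exact (Nat.not_even_iff_odd.mpr hb) (even_iff_two_dvd.mpr (hpa.trans hab))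
  have he_odd : Odd (b.factorization p) := by
    have h1 : b.factorization p = 2 * t.factorization p + a.factorization p := by
      rw [← hbat, Nat.factorization_mul (pow_ne_zero _ ht.ne') ha.ne', Nat.factorization_pow]
      simp
    rw [h1, Nat.factorization_eq_one_of_squarefree hsqf hp hpa]
    exact ⟨_, rfl⟩
  set e := b.factorization p with he
  set m := b / p ^ e with hm
  have hbm : p ^ e * m = b := Nat.ordProj_mul_ordCompl_eq_self b p
  have hpm : ¬ p ∣ m := Nat.not_dvd_ordCompl hp hb0.ne'
  have hcop : p.Coprime m := (Nat.Prime.coprime_iff_not_dvd hp).mpr hpm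
  have hm0 : m ≠ 0 := by rintro h0; rw [h0, mul_zero] at hbm; omega
  obtain ⟨x, hx⟩ := FiniteField.exists_nonsquare (F := ZMod p) (by rw [ZMod.ringChar_zmod_n]; exact hp2)
  obtain ⟨c, hc1, hc2⟩ := Nat.chineseRemainder hcop x.val 1
  refine ⟨c, ?_⟩
  have hJp : J((c : ℤ) | p) = -1 := by
    rw [← jacobiSym.legendreSym.to_jacobiSym, legendreSym.eq_neg_one_iff']
    have : ((c : ℕ) : ZMod p) = x := by
      rw [(ZMod.natCast_eq_natCast_iff _ _ _).mpr hc1, ZMod.natCast_zmod_val]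
    rwa [this]
  have hJm : J((c : ℤ) | m) = 1 := by
    have h1 : (c : ℤ) % m = 1 % m := by exact_mod_cast hc2
    rw [jacobiSym.mod_left' h1, jacobiSym.one_left]
  rw [← hbm, jacobiSym.mul_right' _ (pow_ne_zero e hp.ne_zero) hm0, jacobiSym.pow_right, hJp, hJm, mul_one,
    he_odd.neg_one_pow]

/-! ### Orthogonality over a complete residue system -/

/-- `(c x (d y % Q)) % Q = y` for `y < Q` when `c d ≡ 1 (mod Q)`. [folklore] -/
theorem mul_mul_mod_mod_eq {Q c d y : ℕ} (hcd : c * d % Q = 1) (hQ : 1 < Q) (hy : y < Q) :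
    c * (d * y % Q) % Q = y := by
  have h1 : c * (d * y % Q) ≡ c * (d * y) [MOD Q] := (Nat.mod_modEq _ _).mul_left _
  have h2 : c * (d * y) = (c * d) * y := by ring
  have h3 : (c * d) * y ≡ 1 * y [MOD Q] := by
    have : c * d ≡ 1 [MOD Q] := by rw [Nat.ModEq, hcd, Nat.mod_eq_of_lt hQ]
    exact this.mul_right _
  have h4 := (h1.trans (h2 ▸ h3))
  rw [one_mul] at h4
  rw [h4, Nat.mod_eq_of_lt hy]

/-- **Orthogonality (the vanishing case of Lemma 21.1, used in (21.8))**: for `w₁, w₂` primary primitive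
with `q = |w₁|²|w₂|²` not a perfect square, `Σ_{ζ mod q} (ζ/w₁)(ζ/w₂) = 0`, the sum over the complete
residue system `{r + is : 0 ≤ r, s < q}` of `ℤ[i]` modulo `q`. [cite: FriedlanderIwaniecAnnals1998, Lemma 21.1] -/
theorem sum_dirichletSym_mul_eq_zero {w₁ w₂ : GaussianInt} (h₁ : IsPrimary w₁) (h₁' : IsPrimitive w₁)
    (h₂ : IsPrimary w₂) (h₂' : IsPrimitive w₂) (hsq : ¬ IsSquare (w₁.norm.natAbs * w₂.norm.natAbs)) :
    ∑ r ∈ range (w₁.norm.natAbs * w₂.norm.natAbs), ∑ s ∈ range (w₁.norm.natAbs * w₂.norm.natAbs),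
      dirichletSym ⟨r, s⟩ w₁ * dirichletSym ⟨r, s⟩ w₂ = 0 := by
  set Q := w₁.norm.natAbs * w₂.norm.natAbs with hQ
  have hQodd : Odd Q := (odd_natAbs_norm_of_isPrimary h₁).mul (odd_natAbs_norm_of_isPrimary h₂)
  obtain ⟨c, hc⟩ := exists_jacobiSym_eq_neg_one hQodd hsq
  have hQ1 : 1 < Q := by
    rcases Nat.lt_or_ge 1 Q with h | h
    · exact h
    · exfalso
      interval_cases Q
      · exact (Nat.not_even_iff_odd.mpr hQodd) (by decide)
      · exact hsq ⟨1, rfl⟩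
  -- `c` is invertible modulo `Q`
  have hcQ : c.Coprime Q := by
    by_contra h
    haveI : NeZero Q := ⟨by omega⟩
    have : J((c : ℤ) | Q) = 0 := jacobiSym.eq_zero_iff_not_coprime.mpr (by simpa [Int.gcd_natCast_natCast] using h)
    rw [hc] at this
    norm_num at this
  obtain ⟨d, -, hd⟩ := Nat.exists_mul_mod_eq_one_of_coprime hcQ hQ1
  have hd' : d * c % Q = 1 := by rw [mul_comm]; exact hd
  set F : GaussianInt → ℤ := fun ζ => dirichletSym ζ w₁ * dirichletSym ζ w₂ with hF
  -- twisting by `c` flips the sign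
  have hJc : J((c : ℤ) | w₁.norm.natAbs) * J((c : ℤ) | w₂.norm.natAbs) = -1 := by
    rw [← jacobiSym.mul_right' _ (natAbs_norm_ne_zero_of_isPrimary h₁) (natAbs_norm_ne_zero_of_isPrimary h₂)]
    exact hc
  have hFc : ∀ ζ, F ((c : ℤ) * ζ) = -F ζ := by
    intro ζ
    simp only [hF, dirichletSym_intCast_mul h₁ h₁', dirichletSym_intCast_mul h₂ h₂']
    linear_combination (dirichletSym ζ w₁ * dirichletSym ζ w₂) * hJc
  -- `F` is `Q`-periodic in both coordinates
  have hFper : ∀ ζ ζ' : GaussianInt, (Q : ℤ) ∣ ζ.re - ζ'.re → (Q : ℤ) ∣ ζ.im - ζ'.im → F ζ = F ζ' := by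
    intro ζ ζ' hre him
    have hq₁ : (w₁.norm.natAbs : ℤ) ∣ Q := ⟨w₂.norm.natAbs, by rw [hQ]; push_cast; ring⟩
    have hq₂ : (w₂.norm.natAbs : ℤ) ∣ Q := ⟨w₁.norm.natAbs, by rw [hQ]; push_cast; ring⟩
    simp only [hF]
    rw [dirichletSym_congr w₁ (hq₁.trans hre) (hq₁.trans him), dirichletSym_congr w₂ (hq₂.trans hre) (hq₂.trans him)]
  -- reindex the sum by `ζ ↦ c ζ (mod Q)`
  rw [← sum_product']
  set S := ∑ x ∈ range Q ×ˢ range Q, F ⟨(x.1 : ℤ), (x.2 : ℤ)⟩ with hS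
  have key : S = ∑ x ∈ range Q ×ˢ range Q, F ⟨((c * x.1 % Q : ℕ) : ℤ), ((c * x.2 % Q : ℕ) : ℤ)⟩ := by
    refine sum_nbij' (fun x => (d * x.1 % Q, d * x.2 % Q)) (fun x => (c * x.1 % Q, c * x.2 % Q)) ?_ ?_ ?_ ?_ ?_
    · intro x _; simp only [mem_product, mem_range]; exact ⟨Nat.mod_lt _ (by omega), Nat.mod_lt _ (by omega)⟩
    · intro x _; simp only [mem_product, mem_range]; exact ⟨Nat.mod_lt _ (by omega), Nat.mod_lt _ (by omega)⟩
    · intro x hx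
      simp only [mem_product, mem_range] at hx
      rw [Prod.ext_iff]
      exact ⟨mul_mul_mod_mod_eq hd hQ1 hx.1, mul_mul_mod_mod_eq hd hQ1 hx.2⟩
    · intro x hx
      simp only [mem_product, mem_range] at hx
      rw [Prod.ext_iff]
      exact ⟨mul_mul_mod_mod_eq hd' hQ1 hx.1, mul_mul_mod_mod_eq hd' hQ1 hx.2⟩
    · intro x hx
      simp only [mem_product, mem_range] at hx
      rw [mul_mul_mod_mod_eq hd hQ1 hx.1, mul_mul_mod_mod_eq hd hQ1 hx.2]
  have key2 : ∀ x : ℕ × ℕ, F ⟨((c * x.1 % Q : ℕ) : ℤ), ((c * x.2 % Q : ℕ) : ℤ)⟩ = -F ⟨(x.1 : ℤ), (x.2 : ℤ)⟩ := by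
    intro x
    rw [← hFc]
    apply hFper
    · simp only [Int.natCast_mod, Zsqrtd.re_mul, Zsqrtd.re_intCast, Zsqrtd.im_intCast]
      refine ⟨-((c * x.1 : ℤ) / Q), ?_⟩
      rw [Int.emod_def]; push_cast; ring
    · simp only [Int.natCast_mod, Zsqrtd.im_mul, Zsqrtd.re_intCast, Zsqrtd.im_intCast]
      refine ⟨-((c * x.2 : ℤ) / Q), ?_⟩
      rw [Int.emod_def]; push_cast; ring
  have : S = -S := by
    conv_lhs => rw [key]
    rw [hS, ← sum_neg_distrib]
    exact sum_congr rfl fun x _ => key2 x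
  linarith


/-! ### Sums of periodic functions over intervals and boxes -/

/-- Shifting the window of a `q`-periodic function by one does not change the sum over a period. [folklore] -/
theorem sum_range_add_succ_of_periodic {M : Type*} [AddCommGroup M] {q : ℕ} (g : ℤ → M)
    (hg : ∀ r, g (r + q) = g r) (c : ℤ) :
    ∑ i ∈ range q, g (c + 1 + i) = ∑ i ∈ range q, g (c + i) := by
  have h1 : ∑ i ∈ range q, g (c + 1 + i) = ∑ i ∈ range q, g (c + ((i + 1 : ℕ) : ℤ)) := by
    refine sum_congr rfl fun i _ => ?_
    congr 1; push_cast; ring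
  rw [h1]
  have h2 := Finset.sum_range_succ' (fun i => g (c + (i : ℤ))) q
  have h3 := Finset.sum_range_succ (fun i => g (c + (i : ℤ))) q
  simp only [Nat.cast_zero, add_zero] at h2
  rw [hg] at h3
  exact add_right_cancel (h2.symm.trans h3)

/-- The sum of a `q`-periodic function over any window of `q` consecutive shifts equals the sum over a
period. [folklore] -/
theorem sum_range_add_of_periodic {M : Type*} [AddCommGroup M] {q : ℕ} (g : ℤ → M)
    (hg : ∀ r, g (r + q) = g r) (b : ℤ) :
    ∑ i ∈ range q, g (b + i) = ∑ i ∈ range q, g i := by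
  induction b using Int.induction_on with
  | zero => simp
  | succ b ih => rw [sum_range_add_succ_of_periodic g hg, ih]
  | pred b ih =>
    rw [← ih]
    have := sum_range_add_succ_of_periodic g hg (-(b : ℤ) - 1)
    rw [show -(b : ℤ) - 1 + 1 = -b by ring] at this
    exact this.symm

/-- The sum of a `q`-periodic function over `q` consecutive integers `[b, b + q)`. [folklore] -/
theorem sum_Ico_of_periodic {M : Type*} [AddCommGroup M] {q : ℕ} (g : ℤ → M)
    (hg : ∀ r, g (r + q) = g r) (b : ℤ) :
    ∑ r ∈ Ico b (b + q), g r = ∑ i ∈ range q, g i := by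
  rw [← sum_range_add_of_periodic g hg b]
  refine sum_nbij' (fun r => (r - b).toNat) (fun i => b + i) ?_ ?_ ?_ ?_ ?_
  · intro r hr; rw [mem_Ico] at hr; rw [mem_range]; omega
  · intro i hi; rw [mem_range] at hi; rw [mem_Ico]; omega
  · intro r hr; rw [mem_Ico] at hr
    show b + (((r - b).toNat : ℕ) : ℤ) = r
    omega
  · intro i _
    show (b + (i : ℤ) - b).toNat = i
    omega
  · intro r hr; rw [mem_Ico] at hr
    show g r = g (b + (((r - b).toNat : ℕ) : ℤ))
    congr 1; omega

/-- The sum of a `q`-periodic function over `k q` consecutive integers is `k` times the sum over a period.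
[folklore] -/
theorem sum_Ico_mul_of_periodic {M : Type*} [AddCommGroup M] {q : ℕ} (g : ℤ → M)
    (hg : ∀ r, g (r + q) = g r) (a : ℤ) (k : ℕ) :
    ∑ r ∈ Ico a (a + k * q), g r = k • ∑ i ∈ range q, g i := by
  induction k with
  | zero => simp
  | succ k ih =>
    have e : a + ((k + 1 : ℕ) : ℤ) * q = a + k * q + q := by push_cast; ring
    rw [e, ← Finset.Ico_union_Ico_eq_Ico (b := a + k * q) (le_add_of_nonneg_right (by positivity))
      (le_add_of_nonneg_right (by positivity)), sum_union (Ico_disjoint_Ico_consecutive _ _ _), ih,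
      sum_Ico_of_periodic g hg, succ_nsmul]

/-- A double sum of terms bounded by `1` is at most the product of the cardinalities. [folklore] -/
theorem abs_sum_sum_le_card_mul_card (A B : Finset ℤ) (F : ℤ → ℤ → ℤ) (hF1 : ∀ r s, |F r s| ≤ 1) :
    |∑ r ∈ A, ∑ s ∈ B, F r s| ≤ #A * #B := by
  calc |∑ r ∈ A, ∑ s ∈ B, F r s| ≤ ∑ r ∈ A, |∑ s ∈ B, F r s| := abs_sum_le_sum_abs _ _
    _ ≤ ∑ r ∈ A, (#B : ℤ) := by
        refine sum_le_sum fun r _ => (abs_sum_le_sum_abs _ _).trans ?_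
        have := sum_le_card_nsmul B (fun s => |F r s|) 1 fun s _ => hF1 r s
        simpa using this
    _ = #A * #B := by rw [sum_const, nsmul_eq_mul]

/-- **Box sums of a periodic function with vanishing complete sums.** If `F : ℤ² → ℤ` is `q`-periodic in each
variable, `|F| ≤ 1`, and `Σ_{0 ≤ r, s < q} F(r, s) = 0`, then `|Σ_{|r|, |s| ≤ X} F(r, s)| ≤ 2q(2X+1)`: writing
`2X + 1 = kq + ρ`, the `kq × kq` sub-box is a union of complete residue systems and contributes `0`, the
rest has at most `2q(2X+1)` points. [folklore] -/
theorem abs_sum_box_le_of_periodic {q : ℕ} (hq : 0 < q) (F : ℤ → ℤ → ℤ)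
    (hFr : ∀ r s, F (r + q) s = F r s) (hFs : ∀ r s, F r (s + q) = F r s)
    (hF0 : ∑ r ∈ range q, ∑ s ∈ range q, F r s = 0) (hF1 : ∀ r s, |F r s| ≤ 1) (X : ℕ) :
    |∑ r ∈ Icc (-(X : ℤ)) X, ∑ s ∈ Icc (-(X : ℤ)) X, F r s| ≤ 2 * q * (2 * X + 1) := by
  set L : ℕ := 2 * X + 1 with hL
  set k : ℕ := L / q with hk
  set a : ℤ := -(X : ℤ) with ha
  have hkL : k * q ≤ L := by rw [hk]; exact Nat.div_mul_le_self L q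
  have hLk : L < k * q + q := by
    rw [hk]; have := Nat.div_add_mod L q; have := Nat.mod_lt L hq
    nlinarith [Nat.div_add_mod L q]
  set J₁ : Finset ℤ := Ico a (a + k * q) with hJ₁
  set J₂ : Finset ℤ := Ico (a + k * q) (a + L) with hJ₂
  have hIcc : Icc (-(X : ℤ)) X = J₁ ∪ J₂ := by
    rw [hJ₁, hJ₂, Finset.Ico_union_Ico_eq_Ico (le_add_of_nonneg_right (by positivity))
      (by linarith [(by exact_mod_cast hkL : ((k * q : ℕ) : ℤ) ≤ L)])]
    ext r; simp only [mem_Icc, mem_Ico, ha, hL]; omega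
  have hdisj : Disjoint J₁ J₂ := Ico_disjoint_Ico_consecutive _ _ _
  have hJ₁card : (#J₁ : ℤ) ≤ L := by
    rw [hJ₁, Int.card_Ico]; omega
  have hJ₂card : (#J₂ : ℤ) ≤ q := by
    rw [hJ₂, Int.card_Ico]; omega
  have hJcard : (#(J₁ ∪ J₂) : ℤ) ≤ L := by
    rw [← hIcc, Int.card_Icc]; omega
  -- the complete part vanishes
  have hzero : ∑ r ∈ J₁, ∑ s ∈ J₁, F r s = 0 := by
    have inner : ∀ r, ∑ s ∈ J₁, F r s = k • ∑ t ∈ range q, F r t := fun r =>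
      sum_Ico_mul_of_periodic (fun s => F r s) (fun s => hFs r s) a k
    simp_rw [inner]
    rw [← Finset.smul_sum, Finset.sum_comm]
    have inner2 : ∀ t : ℕ, ∑ r ∈ J₁, F r t = k • ∑ t' ∈ range q, F t' t := fun t =>
      sum_Ico_mul_of_periodic (fun r => F r t) (fun r => hFr r t) a k
    simp_rw [inner2]
    rw [← Finset.smul_sum, Finset.sum_comm, hF0, smul_zero, smul_zero]
  rw [hIcc, sum_union hdisj]
  have e1 : ∑ r ∈ J₁, ∑ s ∈ J₁ ∪ J₂, F r s = ∑ r ∈ J₁, ∑ s ∈ J₁, F r s + ∑ r ∈ J₁, ∑ s ∈ J₂, F r s := by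
    rw [← sum_add_distrib]; exact sum_congr rfl fun r _ => sum_union hdisj
  rw [e1, hzero, zero_add]
  calc |∑ r ∈ J₁, ∑ s ∈ J₂, F r s + ∑ r ∈ J₂, ∑ s ∈ J₁ ∪ J₂, F r s|
      ≤ |∑ r ∈ J₁, ∑ s ∈ J₂, F r s| + |∑ r ∈ J₂, ∑ s ∈ J₁ ∪ J₂, F r s| := abs_add_le _ _
    _ ≤ #J₁ * #J₂ + #J₂ * #(J₁ ∪ J₂) :=
        add_le_add (abs_sum_sum_le_card_mul_card _ _ F hF1) (abs_sum_sum_le_card_mul_card _ _ F hF1)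
    _ ≤ L * q + q * L := by gcongr
    _ = 2 * q * (2 * X + 1) := by rw [hL]; push_cast; ring

/-! ### The bilinear form `Q(M, N)` and the Cauchy–Schwarz step of Lemma 21.2 -/

/-- **FI (21.1)**: `Q = Σ_{w ∈ W} Σ_{z ∈ Z} α_w β_z (z/w)` over finite index sets `W, Z ⊆ ℤ[i]` (in the source
`W` = primary primitive `w` with `|w|² ≤ M`, `Z` = `|z|² ≤ N`). [cite: FriedlanderIwaniecAnnals1998, (21.1)] -/
def dirichletBilin (α β : GaussianInt → ℂ) (W Z : Finset GaussianInt) : ℂ :=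
  ∑ w ∈ W, ∑ z ∈ Z, α w * β z * (dirichletSym z w : ℂ)

/-- Unfolding `dirichletBilin`. [cite: FriedlanderIwaniecAnnals1998, (21.1)] -/
theorem dirichletBilin_def (α β : GaussianInt → ℂ) (W Z : Finset GaussianInt) :
    dirichletBilin α β W Z = ∑ w ∈ W, ∑ z ∈ Z, α w * β z * (dirichletSym z w : ℂ) := rfl

/-- `Q = Σ_z β_z A(z)` with `A(z) = Σ_w α_w (z/w)`. [folklore] -/
theorem dirichletBilin_eq_sum_mul (α β : GaussianInt → ℂ) (W Z : Finset GaussianInt) :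
    dirichletBilin α β W Z = ∑ z ∈ Z, β z * ∑ w ∈ W, α w * (dirichletSym z w : ℂ) := by
  rw [dirichletBilin_def, sum_comm]
  refine sum_congr rfl fun z _ => ?_
  rw [mul_sum]
  exact sum_congr rfl fun w _ => by ring

/-- The correlation sum `T(w₁, w₂) = Σ_{z ∈ Z} (z/w₁)(z/w₂)` (an integer). [folklore] -/
def corrSum (Z : Finset GaussianInt) (w₁ w₂ : GaussianInt) : ℤ := ∑ z ∈ Z, dirichletSym z w₁ * dirichletSym z w₂

/-- **Cauchy–Schwarz and expansion** ("By Cauchy's inequality `Q² ≤ ‖β‖² Σ_z |Σ*_w α_w (z/w)|² =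
‖β‖² Σ*_{w₁} Σ*_{w₂} α_{w₁} ᾱ_{w₂} Σ_z (z/w₁)(z/w₂)`"): for `|α| ≤ 1`,
`‖Q‖² ≤ ‖β‖₂² · Σ_{w₁, w₂ ∈ W} |T(w₁, w₂)|`. [cite: FriedlanderIwaniecAnnals1998, Lemma 21.2 (proof)] -/
theorem norm_sq_dirichletBilin_le (α β : GaussianInt → ℂ) (hα : ∀ w, ‖α w‖ ≤ 1) (W Z : Finset GaussianInt) :
    ‖dirichletBilin α β W Z‖ ^ 2 ≤
      (∑ z ∈ Z, ‖β z‖ ^ 2) * ∑ p ∈ W ×ˢ W, (|corrSum Z p.1 p.2| : ℝ) := by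
  set A : GaussianInt → ℂ := fun z => ∑ w ∈ W, α w * (dirichletSym z w : ℂ) with hA
  -- Cauchy–Schwarz
  have h1 : ‖dirichletBilin α β W Z‖ ≤ ∑ z ∈ Z, ‖β z‖ * ‖A z‖ := by
    rw [dirichletBilin_eq_sum_mul]
    refine (norm_sum_le _ _).trans (le_of_eq (sum_congr rfl fun z _ => norm_mul _ _))
  have h2 : (∑ z ∈ Z, ‖β z‖ * ‖A z‖) ^ 2 ≤ (∑ z ∈ Z, ‖β z‖ ^ 2) * ∑ z ∈ Z, ‖A z‖ ^ 2 :=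
    sum_mul_sq_le_sq_mul_sq Z (fun z => ‖β z‖) (fun z => ‖A z‖)
  -- expansion of `Σ_z ‖A z‖²`
  have h3 : ∑ z ∈ Z, ‖A z‖ ^ 2 ≤ ∑ p ∈ W ×ˢ W, (|corrSum Z p.1 p.2| : ℝ) := by
    have e1 : ∀ z, ((‖A z‖ ^ 2 : ℝ) : ℂ) = A z * conj (A z) := fun z => by
      rw [Complex.mul_conj, Complex.normSq_eq_norm_sq, Complex.ofReal_pow]
    have e2 : ∀ z, A z * conj (A z) =
        ∑ w₁ ∈ W, ∑ w₂ ∈ W, α w₁ * conj (α w₂) * ((dirichletSym z w₁ : ℂ) * (dirichletSym z w₂ : ℂ)) := by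
      intro z
      simp only [hA]
      rw [map_sum, sum_mul_sum]
      refine sum_congr rfl fun w₁ _ => sum_congr rfl fun w₂ _ => ?_
      rw [map_mul, map_intCast]; ring
    have e : ((∑ z ∈ Z, ‖A z‖ ^ 2 : ℝ) : ℂ) =
        ∑ p ∈ W ×ˢ W, α p.1 * conj (α p.2) * (corrSum Z p.1 p.2 : ℂ) := by
      rw [Complex.ofReal_sum]
      simp_rw [e1, e2]
      rw [sum_comm, sum_product]
      refine sum_congr rfl fun w₁ _ => ?_
      rw [sum_comm]
      refine sum_congr rfl fun w₂ _ => ?_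
      rw [corrSum, Int.cast_sum, mul_sum]
      refine sum_congr rfl fun z _ => ?_
      push_cast; ring
    have e' : ∑ z ∈ Z, ‖A z‖ ^ 2 = ‖((∑ z ∈ Z, ‖A z‖ ^ 2 : ℝ) : ℂ)‖ :=
      (Complex.norm_of_nonneg (sum_nonneg fun z _ => by positivity)).symm
    rw [e', e]
    refine (norm_sum_le _ _).trans (sum_le_sum fun p _ => ?_)
    rw [norm_mul, norm_mul, Complex.norm_conj, Complex.norm_intCast, ← Int.cast_abs]
    have h0 : (0 : ℝ) ≤ ((|corrSum Z p.1 p.2| : ℤ) : ℝ) := by positivity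
    calc ‖α p.1‖ * ‖α p.2‖ * ((|corrSum Z p.1 p.2| : ℤ) : ℝ)
        ≤ 1 * ((|corrSum Z p.1 p.2| : ℤ) : ℝ) :=
          mul_le_mul_of_nonneg_right (mul_le_one₀ (hα _) (norm_nonneg _) (hα _)) h0
      _ = _ := one_mul _
  calc ‖dirichletBilin α β W Z‖ ^ 2 ≤ (∑ z ∈ Z, ‖β z‖ * ‖A z‖) ^ 2 := by gcongr
    _ ≤ (∑ z ∈ Z, ‖β z‖ ^ 2) * ∑ z ∈ Z, ‖A z‖ ^ 2 := h2
    _ ≤ (∑ z ∈ Z, ‖β z‖ ^ 2) * ∑ p ∈ W ×ˢ W, (|corrSum Z p.1 p.2| : ℝ) := by gcongr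

/-! ### The correlation sums over a box -/

/-- A sum over the box is a double sum over the coordinates. [folklore] -/
theorem sum_gaussBox_eq (X : ℕ) (f : GaussianInt → ℤ) :
    ∑ z ∈ gaussBox X, f z = ∑ r ∈ Icc (-(X : ℤ)) X, ∑ s ∈ Icc (-(X : ℤ)) X, f ⟨r, s⟩ := by
  rw [gaussBox, sum_image (fun p _ q _ h => by simp only [Zsqrtd.mk.injEq] at h; exact Prod.ext h.1 h.2),
    sum_product]

/-- The trivial bound `|T(w₁, w₂)| ≤ #Z`. [folklore] -/
theorem abs_corrSum_le_card (Z : Finset GaussianInt) (w₁ w₂ : GaussianInt) : |corrSum Z w₁ w₂| ≤ #Z := by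
  rw [corrSum]
  refine (abs_sum_le_sum_abs _ _).trans ?_
  have := sum_le_card_nsmul Z (fun z => |dirichletSym z w₁ * dirichletSym z w₂|) 1 fun z _ => by
    rw [abs_mul]; exact mul_le_one₀ (abs_dirichletSym_le _ _) (abs_nonneg _) (abs_dirichletSym_le _ _)
  simpa using this

/-- **Off-diagonal correlation sums are small**: for `w₁, w₂` primary primitive with `|w₁|²|w₂|²`
not a square, `|Σ_{z ∈ box X} (z/w₁)(z/w₂)| ≤ 2 |w₁|²|w₂|² (2X+1)` (the source's
`Σ_ζ (ζ/w₁)(ζ/w₂){πN/q² + O(√N/q + 1)}` with Lemma 21.1, in box form).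
[cite: FriedlanderIwaniecAnnals1998, Lemma 21.2 (proof)] -/
theorem abs_corrSum_gaussBox_le {w₁ w₂ : GaussianInt} (h₁ : IsPrimary w₁ ∧ IsPrimitive w₁)
    (h₂ : IsPrimary w₂ ∧ IsPrimitive w₂)
    (hsq : ¬ IsSquare (w₁.norm.natAbs * w₂.norm.natAbs)) (X : ℕ) :
    |corrSum (gaussBox X) w₁ w₂| ≤ 2 * (w₁.norm.natAbs * w₂.norm.natAbs : ℕ) * (2 * X + 1) := by
  set Q := w₁.norm.natAbs * w₂.norm.natAbs with hQ
  have hQpos : 0 < Q :=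
    Nat.pos_of_ne_zero (mul_ne_zero (natAbs_norm_ne_zero_of_isPrimary h₁.1) (natAbs_norm_ne_zero_of_isPrimary h₂.1))
  rw [corrSum, sum_gaussBox_eq]
  have hq₁ : (w₁.norm.natAbs : ℤ) ∣ Q := ⟨w₂.norm.natAbs, by rw [hQ]; push_cast; ring⟩
  have hq₂ : (w₂.norm.natAbs : ℤ) ∣ Q := ⟨w₁.norm.natAbs, by rw [hQ]; push_cast; ring⟩
  refine abs_sum_box_le_of_periodic hQpos (fun r s => dirichletSym ⟨r, s⟩ w₁ * dirichletSym ⟨r, s⟩ w₂)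
    ?_ ?_ ?_ ?_ X
  · intro r s
    rw [dirichletSym_congr w₁ (z := ⟨r + Q, s⟩) (z' := ⟨r, s⟩) (by simpa using hq₁) (by simp),
      dirichletSym_congr w₂ (z := ⟨r + Q, s⟩) (z' := ⟨r, s⟩) (by simpa using hq₂) (by simp)]
  · intro r s
    rw [dirichletSym_congr w₁ (z := ⟨r, s + Q⟩) (z' := ⟨r, s⟩) (by simp) (by simpa using hq₁),
      dirichletSym_congr w₂ (z := ⟨r, s + Q⟩) (z' := ⟨r, s⟩) (by simp) (by simpa using hq₂)]
  · have := sum_dirichletSym_mul_eq_zero h₁.1 h₁.2 h₂.1 h₂.2 hsq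
    rw [← hQ] at this
    exact this
  · intro r s
    rw [abs_mul]; exact mul_le_one₀ (abs_dirichletSym_le _ _) (abs_nonneg _) (abs_dirichletSym_le _ _)

/-- The pairs `(w₁, w₂) ∈ W²` with `|w₁|²|w₂|²` a perfect square. [folklore] -/
def sqNormPairs (W : Finset GaussianInt) : Finset (GaussianInt × GaussianInt) :=
  (W ×ˢ W).filter fun p => IsSquare (p.1.norm.natAbs * p.2.norm.natAbs)

/-- **Lemma 21.2, box form.** For `W` a finite set of primary primitive `w` with `|w|² ≤ M`, `|α| ≤ 1`,
any `β`, and the box `Z = {|Re z|, |Im z| ≤ X}`: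
`‖Q‖² ≤ ‖β‖₂² ((2X+1)² SQ(W) + 2 M² (2X+1) |W|²)`. [cite: FriedlanderIwaniecAnnals1998, Lemma 21.2] -/
theorem norm_sq_dirichletBilin_box_le {M : ℕ} (W : Finset GaussianInt)
    (hW : ∀ w ∈ W, (IsPrimary w ∧ IsPrimitive w) ∧ w.norm.natAbs ≤ M) (α β : GaussianInt → ℂ)
    (hα : ∀ w, ‖α w‖ ≤ 1)
    (X : ℕ) :
    ‖dirichletBilin α β W (gaussBox X)‖ ^ 2 ≤
      (∑ z ∈ gaussBox X, ‖β z‖ ^ 2) *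
        ((2 * X + 1) ^ 2 * #(sqNormPairs W) + 2 * M ^ 2 * (2 * X + 1) * #W ^ 2) := by
  refine (norm_sq_dirichletBilin_le α β hα W (gaussBox X)).trans ?_
  refine mul_le_mul_of_nonneg_left ?_ (sum_nonneg fun z _ => by positivity)
  -- split the pairs into squares and non-squares
  classical
  have hsplit := (sum_filter_add_sum_filter_not (W ×ˢ W)
    (fun p : GaussianInt × GaussianInt => IsSquare (p.1.norm.natAbs * p.2.norm.natAbs))
    (fun p => (|corrSum (gaussBox X) p.1 p.2| : ℝ))).symm
  rw [hsplit]
  have hbox : (#(gaussBox X) : ℝ) = (2 * X + 1) ^ 2 := by rw [card_gaussBox]; push_cast; ring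
  have hA : ∑ p ∈ (W ×ˢ W).filter (fun p => IsSquare (p.1.norm.natAbs * p.2.norm.natAbs)),
      (|corrSum (gaussBox X) p.1 p.2| : ℝ) ≤ (2 * X + 1) ^ 2 * #(sqNormPairs W) := by
    rw [sqNormPairs]
    have : ∀ p ∈ (W ×ˢ W).filter (fun p => IsSquare (p.1.norm.natAbs * p.2.norm.natAbs)),
        (|corrSum (gaussBox X) p.1 p.2| : ℝ) ≤ (2 * X + 1) ^ 2 := by
      intro p _
      rw [← hbox]; exact_mod_cast abs_corrSum_le_card (gaussBox X) p.1 p.2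
    refine (sum_le_card_nsmul _ _ _ this).trans ?_
    rw [nsmul_eq_mul, mul_comm]
  have hB : ∑ p ∈ (W ×ˢ W).filter (fun p => ¬ IsSquare (p.1.norm.natAbs * p.2.norm.natAbs)),
      (|corrSum (gaussBox X) p.1 p.2| : ℝ) ≤ 2 * M ^ 2 * (2 * X + 1) * #W ^ 2 := by
    have : ∀ p ∈ (W ×ˢ W).filter (fun p => ¬ IsSquare (p.1.norm.natAbs * p.2.norm.natAbs)),
        (|corrSum (gaussBox X) p.1 p.2| : ℝ) ≤ 2 * M ^ 2 * (2 * X + 1) := by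
      intro p hp
      rw [mem_filter, mem_product] at hp
      obtain ⟨⟨hp1, hp2⟩, hns⟩ := hp
      obtain ⟨ho1, hM1⟩ := hW _ hp1
      obtain ⟨ho2, hM2⟩ := hW _ hp2
      have h := abs_corrSum_gaussBox_le ho1 ho2 hns X
      have hq : ((p.1.norm.natAbs * p.2.norm.natAbs : ℕ) : ℤ) ≤ (M : ℤ) ^ 2 := by
        have : p.1.norm.natAbs * p.2.norm.natAbs ≤ M ^ 2 := by rw [sq]; exact Nat.mul_le_mul hM1 hM2
        exact_mod_cast this
      have hz : |corrSum (gaussBox X) p.1 p.2| ≤ 2 * (M : ℤ) ^ 2 * (2 * X + 1) :=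
        h.trans (by gcongr)
      exact_mod_cast hz
    refine (sum_le_card_nsmul _ _ _ this).trans ?_
    rw [nsmul_eq_mul]
    set NS := (W ×ˢ W).filter (fun p => ¬ IsSquare (p.1.norm.natAbs * p.2.norm.natAbs)) with hNS
    have hc : (#NS : ℝ) ≤ (#W : ℝ) ^ 2 := by
      have := card_filter_le (W ×ˢ W) (fun p => ¬ IsSquare (p.1.norm.natAbs * p.2.norm.natAbs))
      rw [card_product] at this
      calc (#NS : ℝ) ≤ ((#W * #W : ℕ) : ℝ) := by exact_mod_cast this
        _ = (#W : ℝ) ^ 2 := by push_cast; ring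
    calc (#NS : ℝ) * (2 * (M : ℝ) ^ 2 * (2 * X + 1))
        ≤ (#W : ℝ) ^ 2 * (2 * (M : ℝ) ^ 2 * (2 * X + 1)) := by gcongr
      _ = 2 * (M : ℝ) ^ 2 * (2 * X + 1) * (#W : ℝ) ^ 2 := by ring
  linarith

/-! ### Counting the square pairs: `SQ(W) ≪ M^{1+ε}` -/

/-- **The square pairs are few**: if every `w ∈ W` has `1 ≤ |w|² ≤ M` then
`SQ(W) ≤ Σ_{t=1}^{M} 16 τ(t²)³` (`|w₁|²|w₂|² = t²`, `|w₁|² = d ∣ t²`, and `r(d), r(t²/d) ≤ 4τ(t²)`).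
[cite: FriedlanderIwaniecAnnals1998, Lemma 21.2 (proof)] -/
theorem card_sqNormPairs_le_sum {M : ℕ} (W : Finset GaussianInt)
    (hW : ∀ w ∈ W, w.norm.natAbs ≠ 0 ∧ w.norm.natAbs ≤ M) :
    #(sqNormPairs W) ≤ ∑ t ∈ Icc 1 M, 16 * #(t ^ 2).divisors ^ 3 := by
  classical
  -- `sqNormPairs W ⊆ ⋃_t ⋃_{d ∣ t²} normEq d × normEq (t²/d)`
  set T : Finset (GaussianInt × GaussianInt) :=
    (Icc 1 M).biUnion fun t => (t ^ 2).divisors.biUnion fun d => normEq d ×ˢ normEq (t ^ 2 / d) with hT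
  have hsub : sqNormPairs W ⊆ T := by
    intro p hp
    rw [sqNormPairs, mem_filter, mem_product] at hp
    obtain ⟨⟨hp1, hp2⟩, ⟨t, ht⟩⟩ := hp
    obtain ⟨h10, h1M⟩ := hW _ hp1
    obtain ⟨h20, h2M⟩ := hW _ hp2
    have ht2 : p.1.norm.natAbs * p.2.norm.natAbs = t ^ 2 := by rw [ht]; ring
    have htpos : 0 < t := by
      rcases Nat.eq_zero_or_pos t with rfl | h
      · exfalso
        have h0 : p.1.norm.natAbs * p.2.norm.natAbs = 0 := by simpa using ht2
        rcases Nat.mul_eq_zero.mp h0 with h | h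
        · exact h10 h
        · exact h20 h
      · exact h
    have htM : t ≤ M := by nlinarith [Nat.mul_le_mul h1M h2M]
    rw [hT, mem_biUnion]
    refine ⟨t, mem_Icc.mpr ⟨htpos, htM⟩, ?_⟩
    rw [mem_biUnion]
    refine ⟨p.1.norm.natAbs, Nat.mem_divisors.mpr ⟨⟨p.2.norm.natAbs, ht2.symm⟩, by positivity⟩, ?_⟩
    rw [mem_product]
    refine ⟨mem_normEq.mpr (Int.natAbs_of_nonneg (GaussianInt.norm_nonneg _)).symm, mem_normEq.mpr ?_⟩
    rw [← ht2, Nat.mul_div_cancel_left _ (Nat.pos_of_ne_zero h10)]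
    exact (Int.natAbs_of_nonneg (GaussianInt.norm_nonneg _)).symm
  refine (card_le_card hsub).trans ?_
  rw [hT]
  refine card_biUnion_le.trans (sum_le_sum fun t ht => ?_)
  have ht0 : t ^ 2 ≠ 0 := pow_ne_zero 2 (Nat.ne_of_gt (mem_Icc.mp ht).1)
  refine card_biUnion_le.trans ?_
  calc ∑ d ∈ (t ^ 2).divisors, #(normEq d ×ˢ normEq (t ^ 2 / d))
      ≤ ∑ d ∈ (t ^ 2).divisors, (4 * #(t ^ 2).divisors) * (4 * #(t ^ 2).divisors) := by
        refine sum_le_sum fun d hd => ?_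
        rw [card_product]
        have hd0 : d ≠ 0 := Nat.ne_of_gt (Nat.pos_of_mem_divisors hd)
        have hdvd : d ∣ t ^ 2 := Nat.dvd_of_mem_divisors hd
        have hd'0 : t ^ 2 / d ≠ 0 := by
          intro h; rw [Nat.div_eq_zero_iff] at h; rcases h with h | h
          · exact hd0 h
          · exact absurd (Nat.le_of_dvd (Nat.pos_of_ne_zero ht0) hdvd) (not_le.mpr h)
        have hdvd' : t ^ 2 / d ∣ t ^ 2 := Nat.div_dvd_of_dvd hdvd
        exact Nat.mul_le_mul
          ((card_normEq_le d hd0).trans (Nat.mul_le_mul_left 4 (card_le_card (Nat.divisors_subset_of_dvd ht0 hdvd))))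
          ((card_normEq_le _ hd'0).trans (Nat.mul_le_mul_left 4 (card_le_card (Nat.divisors_subset_of_dvd ht0 hdvd'))))
    _ = 16 * #(t ^ 2).divisors ^ 3 := by rw [sum_const, smul_eq_mul]; ring

/-- **`SQ(W) ≪_ε M^{1+ε}`**: for `ε > 0` there is `C` such that `SQ(W) ≤ C M^{1+ε}` whenever every `w ∈ W` has
`1 ≤ |w|² ≤ M` (divisor bound `τ(t²) ≪ t^{ε/3}`). [cite: FriedlanderIwaniecAnnals1998, Lemma 21.2 (proof)] -/
theorem card_sqNormPairs_le_rpow {ε : ℝ} (hε : 0 < ε) :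
    ∃ C : ℝ, 0 < C ∧ ∀ (M : ℕ) (W : Finset GaussianInt),
      (∀ w ∈ W, w.norm.natAbs ≠ 0 ∧ w.norm.natAbs ≤ M) → (#(sqNormPairs W) : ℝ) ≤ C * (M : ℝ) ^ (1 + ε) := by
  obtain ⟨C, hC1, hC⟩ := Literature.NumberTheory.Sieve.exists_card_divisors_le_mul_rpow (ε := ε / 6) (by positivity)
  refine ⟨16 * C ^ 3, by positivity, fun M W hW => ?_⟩
  have h1 : (#(sqNormPairs W) : ℝ) ≤ ∑ t ∈ Icc 1 M, (16 * (#(t ^ 2).divisors : ℝ) ^ 3) := by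
    have := card_sqNormPairs_le_sum W hW
    calc (#(sqNormPairs W) : ℝ) ≤ ((∑ t ∈ Icc 1 M, 16 * #(t ^ 2).divisors ^ 3 : ℕ) : ℝ) := by exact_mod_cast this
      _ = _ := by push_cast; rfl
  refine h1.trans ?_
  -- each term is at most `16 C³ M^ε`
  have hterm : ∀ t ∈ Icc 1 M, (16 * (#(t ^ 2).divisors : ℝ) ^ 3) ≤ 16 * C ^ 3 * (M : ℝ) ^ ε := by
    intro t ht
    obtain ⟨ht1, htM⟩ := mem_Icc.mp ht
    have ht0 : t ^ 2 ≠ 0 := pow_ne_zero 2 (by omega)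
    have hτ := hC (t ^ 2) ht0
    have hτ' : (#(t ^ 2).divisors : ℝ) ≤ C * (M : ℝ) ^ (ε / 3) := by
      refine hτ.trans ?_
      have : ((t ^ 2 : ℕ) : ℝ) ^ (ε / 6) ≤ ((M : ℝ) ^ 2) ^ (ε / 6) := by
        apply Real.rpow_le_rpow (by positivity) _ (by positivity)
        have : (t : ℝ) ≤ M := by exact_mod_cast htM
        push_cast; nlinarith
      rw [← Real.rpow_natCast (M : ℝ) 2, ← Real.rpow_mul (by positivity)] at this
      norm_num at this
      calc C * ((t ^ 2 : ℕ) : ℝ) ^ (ε / 6) ≤ C * (M : ℝ) ^ (2 * (ε / 6)) := by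
            gcongr; push_cast; exact this
        _ = C * (M : ℝ) ^ (ε / 3) := by ring_nf
    have hτ0 : (0 : ℝ) ≤ #(t ^ 2).divisors := by positivity
    calc 16 * (#(t ^ 2).divisors : ℝ) ^ 3 ≤ 16 * (C * (M : ℝ) ^ (ε / 3)) ^ 3 := by gcongr
      _ = 16 * C ^ 3 * ((M : ℝ) ^ (ε / 3)) ^ (3 : ℕ) := by ring
      _ = 16 * C ^ 3 * (M : ℝ) ^ ε := by
          rw [← Real.rpow_natCast ((M : ℝ) ^ (ε / 3)) 3, ← Real.rpow_mul (by positivity)]; norm_num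
  refine (sum_le_sum hterm).trans ?_
  rw [sum_const, Nat.card_Icc, nsmul_eq_mul]
  have hM : ((M + 1 - 1 : ℕ) : ℝ) = M := by push_cast; ring
  rw [hM, Real.rpow_add_of_nonneg (by positivity) (by norm_num) hε.le, Real.rpow_one]
  ring_nf
  rfl

end Literature.NumberTheory.Sieve.FriedlanderIwaniecPrimes

end
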